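import Mathlib.CategoryTheory.Monoidal.Cartesian.Grp
import HarnessLib

/-!
# A group object from a law, a unit and an inverse satisfying the group axioms ON `T`-POINTS (functor of points, Yoneda)

Topic `Literature/AlgebraicGeometry/GroupSchemes`; namespace `Literature.AlgebraicGeometry.GroupSchemes`.  THEOREMS ONLY (no definition, no named fact, no
instance, no notation, no `sorry`); valid in ANY cartesian monoidal category `C` (for `C = Over S`: group SCHEMES over `S`, Mathlib
`CategoryTheory.Over.cartesianMonoidalCategory`).  Sibling of ★ `NeronModels/GroupObjectOfShearIso.exists_grpObj_of_isIso_shear` (associative law + shear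
isomorphisms + point ⇒ group object), SAME road (Mathlib `GrpObj.ofRepresentableBy` on the presheaf of groups `T ↦ X(T)`), for the situation where the
unit AND the inverse are GIVEN as morphisms and the four group axioms are known on `T`-points ([SGA3] Exp. I, 2.3.3: a group structure on the functor of
points of `X` is a group-object structure on `X`; [MumfordFogartyKirwan1994] Ch. 0 §1 (p. 2) «group pre-schemes» via functors of points).  This is the
form in which [MumfordFogartyKirwan1994] Ch. 6 §3, proof of Prop. 6.16 (p. 126) hands over the universal law of the LAW LOCUS `Z ⊂ Hom_S(X ×_S X, X) ×_S
Hom_S(X, X)`: the restrictions `(μ_Z, ι_Z)` of the universal morphisms satisfy the identities because `Z` lies in their equalisers (cell hodgecm-mathlib,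
FLOOR 0, P1 sub-line F-4 layer 2, sub-stub (II-c₁), B-p20 (g14)).

* **`exists_grpObj_of_pointwise`** — `m : X ⊗ X ⟶ X`, `e : 𝟙 ⟶ X`, `i : X ⟶ X` with, for all `T`-points `a b c : T ⟶ X`: `(a·b)·c = a·(b·c)`,
  `e·a = a`, `a·e = a`, `a⁻¹·a = e` (`a·b := lift a b ≫ m`, `e_T := toUnit T ≫ e`, `a⁻¹ := a ≫ i`) ⟹ `∃ G : GrpObj X` with `μ[X] = m`, `η[X] = e`,
  `ι[X] = i`;
* `lift_lift_comp_mul_assoc'`, `lift_toUnit_one_comp_mul`, `lift_one_toUnit_comp_mul`, `lift_inv_comp_mul`, `lift_comp_inv_mul` — conversely, for ANY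
  group object the `T`-point operations `lift a b ≫ μ`, `toUnit ≫ η`, `a ≫ ι` satisfy these identities (Mathlib's scoped `Hom.group`, spelled out).

HC_CM is proved only modulo the 7 printed citations until rung 0 closes; this file discharges none of them.

## References
* [SGA3] M. Demazure, A. Grothendieck, *Schémas en groupes I*, Exp. I, 2.3.3 (group functors and group objects).
* [MumfordFogartyKirwan1994] D. Mumford, J. Fogarty, F. Kirwan, *Geometric Invariant Theory*, 3rd ed. (1994), Ch. 0 §1 (p. 2); Ch. 6 §3 Prop. 6.16,
  proof (p. 126).
-/

set_option autoImplicit false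

noncomputable section

open CategoryTheory MonoidalCategory CartesianMonoidalCategory Opposite

universe v u

namespace Literature.AlgebraicGeometry.GroupSchemes

variable {C : Type u} [Category.{v} C] [CartesianMonoidalCategory C] {X : C}

/-- **A group object from pointwise group laws** ([SGA3] I 2.3.3; [MumfordFogartyKirwan1994] Ch. 0 §1): if `m : X ⊗ X ⟶ X`, `e : 𝟙 ⟶ X`,
`i : X ⟶ X` satisfy associativity, two-sided unit and left inverse ON `T`-POINTS (`a·b := lift a b ≫ m`), then `X` carries a group-object structure with
EXACTLY these structure morphisms.  Proof: `T ↦ (T ⟶ X)` is a presheaf of groups represented by `X` (Mathlib `GrpObj.ofRepresentableBy`).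
[cite: MumfordFogartyKirwan1994, Ch. 0 §1 (p. 2) and Ch. 6 §3 Proposition 6.16, proof (p. 126)] -/
theorem exists_grpObj_of_pointwise (m : X ⊗ X ⟶ X) (e : 𝟙_ C ⟶ X) (i : X ⟶ X)
    (hassoc : ∀ {T : C} (a b c : T ⟶ X), lift (lift a b ≫ m) c ≫ m = lift a (lift b c ≫ m) ≫ m)
    (hone_mul : ∀ {T : C} (a : T ⟶ X), lift (toUnit T ≫ e) a ≫ m = a)
    (hmul_one : ∀ {T : C} (a : T ⟶ X), lift a (toUnit T ≫ e) ≫ m = a)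
    (hinv_mul : ∀ {T : C} (a : T ⟶ X), lift (a ≫ i) a ≫ m = toUnit T ≫ e) :
    ∃ G : GrpObj X, @MonObj.mul C _ _ X G.toMonObj = m ∧ @MonObj.one C _ _ X G.toMonObj = e ∧ @GrpObj.inv C _ _ X G = i := by
  classical
  -- the group structures on `T`-points
  letI grp : ∀ T : C, Group (T ⟶ X) := fun T =>
    { mul := fun a b => lift a b ≫ m
      mul_assoc := fun a b c => hassoc a b c
      one := toUnit T ≫ e
      one_mul := fun a => hone_mul a
      mul_one := fun a => hmul_one a
      inv := fun a => a ≫ i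
      inv_mul_cancel := fun a => hinv_mul a }
  -- the presheaf of groups `T ↦ X(T)` and its representability by `X`
  let F : Cᵒᵖ ⥤ GrpCat.{v} :=
    { obj := fun T => GrpCat.of (T.unop ⟶ X)
      map := fun {T T'} g => GrpCat.ofHom (MonoidHom.mk' (fun a : T.unop ⟶ X => g.unop ≫ a) fun a b => by
        change g.unop ≫ (lift a b ≫ m) = lift (g.unop ≫ a) (g.unop ≫ b) ≫ m
        rw [← Category.assoc, comp_lift])
      map_id := fun T => by ext a; exact Category.id_comp a
      map_comp := fun f g => by ext a; exact Category.assoc _ _ _ }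
  let α : (F ⋙ forget GrpCat).RepresentableBy X :=
    { homEquiv := fun {T} => Equiv.refl _
      homEquiv_comp := fun f g => rfl }
  refine ⟨GrpObj.ofRepresentableBy X F α, ?_, ?_, ?_⟩
  · change lift (fst X X) (snd X X) ≫ m = m
    rw [lift_fst_snd, Category.id_comp]
  · change toUnit (𝟙_ C) ≫ e = e
    rw [toUnit_unique (toUnit (𝟙_ C)) (𝟙 _), Category.id_comp]
  · change 𝟙 X ≫ i = i
    rw [Category.id_comp]

/-! ### Conversely: the `T`-point operations of a group object -/

section Converse

variable [GrpObj X]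

open scoped MonObj

/-- **Pointwise associativity** of a group object: `(a·b)·c = a·(b·c)` for `T`-points. [cite: MumfordFogartyKirwan1994, Ch. 0 §1 (p. 2)] -/
theorem lift_lift_comp_mul_assoc' {T : C} (a b c : T ⟶ X) :
    lift (lift a b ≫ μ[X]) c ≫ μ[X] = lift a (lift b c ≫ μ[X]) ≫ μ[X] := by
  exact mul_assoc a b c

/-- **Pointwise left unit**: `e·a = a`. [cite: MumfordFogartyKirwan1994, Ch. 0 §1 (p. 2)] -/
theorem lift_toUnit_one_comp_mul {T : C} (a : T ⟶ X) : lift (toUnit T ≫ η[X]) a ≫ μ[X] = a := by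
  exact one_mul a

/-- **Pointwise right unit**: `a·e = a`. [cite: MumfordFogartyKirwan1994, Ch. 0 §1 (p. 2)] -/
theorem lift_one_toUnit_comp_mul {T : C} (a : T ⟶ X) : lift a (toUnit T ≫ η[X]) ≫ μ[X] = a := by
  exact mul_one a

/-- **Pointwise left inverse**: `a⁻¹·a = e`. [cite: MumfordFogartyKirwan1994, Ch. 0 §1 (p. 2)] -/
theorem lift_inv_comp_mul {T : C} (a : T ⟶ X) : lift (a ≫ ι[X]) a ≫ μ[X] = toUnit T ≫ η[X] := by
  exact inv_mul_cancel a

/-- **Pointwise right inverse**: `a·a⁻¹ = e`. [cite: MumfordFogartyKirwan1994, Ch. 0 §1 (p. 2)] -/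
theorem lift_comp_inv_mul {T : C} (a : T ⟶ X) : lift a (a ≫ ι[X]) ≫ μ[X] = toUnit T ≫ η[X] := by
  exact mul_inv_cancel a

end Converse

end Literature.AlgebraicGeometry.GroupSchemes

end
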